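import Summits.MatrixMultiplication.OmegaCensus.STPPSmallPatternKernelSearchX2
import Summits.MatrixMultiplication.OmegaCensus.STPPSmallPatternKernelProduct
import Summits.MatrixMultiplication.OmegaCensus.STPPSmallPatternNone211K6P5x5Part1
import Summits.MatrixMultiplication.OmegaCensus.STPPSmallPatternNone211K6P5x5Part2
import Summits.MatrixMultiplication.OmegaCensus.STPPSmallPatternNone211K6P5x5Part3
import Summits.MatrixMultiplication.OmegaCensus.STPPSmallPatternNone211K6P5x5Part4
import Summits.MatrixMultiplication.OmegaCensus.STPPSmallPatternNone211K6P5x5Part5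
import Summits.MatrixMultiplication.OmegaCensus.STPPSmallPatternNone211K6P5x5Part6
import Summits.MatrixMultiplication.OmegaCensus.STPPSmallPatternNone211K6P5x5Part7

/-!
# ω-census, `(2,1,1)^6` is infeasible in `ℤ/5 × ℤ/5` (kernel theorem)

HONEST FRAMING (pub-omega census; verbatim): lottery ticket; floor = certified bounds/negative ranges.
Census STRUCTURE bookkeeping of the STPP track (seat pub-omega-eng2 = ENG2, gen 33, on the kernel engine + reflection of seat
pub-omega-stpp-3 gen 23; STRUCTURE row B5, the threshold column `T1(H) = max {k : (2,1,1)^k ⊆ H}`, lower side of the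
`k = 6` ORDER LAW `(2,1,1)⁶ ⊆ G ↔ 30 ≤ |G|`), not progress on `ω`: small patterns in small groups bound no exponent.

The kernel mask search `STPP211Neg.search2` (two-level chunks, `STPPSmallPatternKernelSearchX2.lean`) on `prodGC 5 (zcode 5)` over the chunks of the
7 part files returns `true` (`decide +kernel`, 15 chunk theorems, 10023213 mask translations ≈ 2499 s of kernel time);
the chunks of every representative cover every PAIR of codes; every nonzero `d` is carried into the representative list
by a linear automorphism (one matrix of `GL₂(𝔽₅)` per nonzero vector, built from `fst`/`snd`/`prod`/`mulLeft`, carrying it to `(0,1)`) (kernel decisions); `STPP211Neg.not_exists_isSTPP_211_of_search2` turns this into: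
**no `A B C : Fin 6 → Finset (ZMod 5 × ZMod 5)` with `IsSTPP A B C` (CKSU Def. 5.1, tree `IsSTPP`) and `|Aᵢ| = 2`, `|Bᵢ| = |Cᵢ| = 1.**

References: H. Cohn, R. Kleinberg, B. Szegedy, C. Umans, FOCS 2005 (arXiv:math/0511460), Def. 5.1.  Record: pub-omega HOME
`pub-omega-eng2-g33/results/none6/` (ENG2's C mirror `k211c.c` of the kernel tree — validated against stpp-3's Python mirror
`k211v3.py` on the landed `k = 5` cells to the translation count — gives COMPLETE NONE on this cell with 10023213 mask
translations; per-`(d,c₁,c₂)` cost tables, planner `plan6.py`; farm calibration 249 µs per translation; not used by the proofs).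
-/

open Literature.Computability.AlgebraicComplexity

set_option Elab.async false  -- several kernel pieces: elaborate sequentially (memory)

namespace Summit.MatrixMultiplication.OmegaCensus

namespace STPP211Neg

/-- All chunks of `ℤ/5 × ℤ/5`, `k = 6` (the parts' lists). -/
def P5_5k6.chunks : List (ℕ × ℕ × ℕ) :=
  P5_5k6.part1 ++ P5_5k6.part2 ++ P5_5k6.part3 ++ P5_5k6.part4 ++ P5_5k6.part5 ++ P5_5k6.part6 ++ P5_5k6.part7

/-- The kernel search over all chunks of `ℤ/5 × ℤ/5`, `k = 6` (assembled from the parts). -/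
theorem P5_5k6.search_all : search2 (prodGC 5 (zcode 5)) 6 P5_5k6.chunks = true := by
  simp only [P5_5k6.chunks, search2_append, P5_5k6.ps1, P5_5k6.ps2, P5_5k6.ps3, P5_5k6.ps4, P5_5k6.ps5, P5_5k6.ps6, P5_5k6.ps7, Bool.and_self]

/-- Representative codes of `ℤ/5 × ℤ/5` `∖ 0` (`GL₂(𝔽₅)` is transitive on nonzero vectors: the single representative `(0,1)`, code `1`). -/
def P5_5k6.reps : List ℕ :=
  [1]

/-- Linear automorphisms `(a,b) ↦ (αa+βb, γa+δb)` (one per nonzero vector, carrying it to `(0, 1)`) of `ℤ/5 × ℤ/5`. -/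
def P5_5k6.auts : List (ZMod 5 × ZMod 5 →+ ZMod 5 × ZMod 5) :=
  [(AddMonoidHom.mulLeft ((1, 0) : ZMod 5 × ZMod 5)).comp ((AddMonoidHom.fst (ZMod 5) (ZMod 5)).prod (AddMonoidHom.fst (ZMod 5) (ZMod 5))) + (AddMonoidHom.mulLeft ((0, 1) : ZMod 5 × ZMod 5)).comp ((AddMonoidHom.snd (ZMod 5) (ZMod 5)).prod (AddMonoidHom.snd (ZMod 5) (ZMod 5))),
    (AddMonoidHom.mulLeft ((2, 0) : ZMod 5 × ZMod 5)).comp ((AddMonoidHom.fst (ZMod 5) (ZMod 5)).prod (AddMonoidHom.fst (ZMod 5) (ZMod 5))) + (AddMonoidHom.mulLeft ((0, 3) : ZMod 5 × ZMod 5)).comp ((AddMonoidHom.snd (ZMod 5) (ZMod 5)).prod (AddMonoidHom.snd (ZMod 5) (ZMod 5))),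
    (AddMonoidHom.mulLeft ((3, 0) : ZMod 5 × ZMod 5)).comp ((AddMonoidHom.fst (ZMod 5) (ZMod 5)).prod (AddMonoidHom.fst (ZMod 5) (ZMod 5))) + (AddMonoidHom.mulLeft ((0, 2) : ZMod 5 × ZMod 5)).comp ((AddMonoidHom.snd (ZMod 5) (ZMod 5)).prod (AddMonoidHom.snd (ZMod 5) (ZMod 5))),
    (AddMonoidHom.mulLeft ((4, 0) : ZMod 5 × ZMod 5)).comp ((AddMonoidHom.fst (ZMod 5) (ZMod 5)).prod (AddMonoidHom.fst (ZMod 5) (ZMod 5))) + (AddMonoidHom.mulLeft ((0, 4) : ZMod 5 × ZMod 5)).comp ((AddMonoidHom.snd (ZMod 5) (ZMod 5)).prod (AddMonoidHom.snd (ZMod 5) (ZMod 5))),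
    (AddMonoidHom.mulLeft ((0, 1) : ZMod 5 × ZMod 5)).comp ((AddMonoidHom.fst (ZMod 5) (ZMod 5)).prod (AddMonoidHom.fst (ZMod 5) (ZMod 5))) + (AddMonoidHom.mulLeft ((4, 0) : ZMod 5 × ZMod 5)).comp ((AddMonoidHom.snd (ZMod 5) (ZMod 5)).prod (AddMonoidHom.snd (ZMod 5) (ZMod 5))),
    (AddMonoidHom.mulLeft ((1, 1) : ZMod 5 × ZMod 5)).comp ((AddMonoidHom.fst (ZMod 5) (ZMod 5)).prod (AddMonoidHom.fst (ZMod 5) (ZMod 5))) + (AddMonoidHom.mulLeft ((4, 0) : ZMod 5 × ZMod 5)).comp ((AddMonoidHom.snd (ZMod 5) (ZMod 5)).prod (AddMonoidHom.snd (ZMod 5) (ZMod 5))),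
    (AddMonoidHom.mulLeft ((2, 1) : ZMod 5 × ZMod 5)).comp ((AddMonoidHom.fst (ZMod 5) (ZMod 5)).prod (AddMonoidHom.fst (ZMod 5) (ZMod 5))) + (AddMonoidHom.mulLeft ((4, 0) : ZMod 5 × ZMod 5)).comp ((AddMonoidHom.snd (ZMod 5) (ZMod 5)).prod (AddMonoidHom.snd (ZMod 5) (ZMod 5))),
    (AddMonoidHom.mulLeft ((3, 1) : ZMod 5 × ZMod 5)).comp ((AddMonoidHom.fst (ZMod 5) (ZMod 5)).prod (AddMonoidHom.fst (ZMod 5) (ZMod 5))) + (AddMonoidHom.mulLeft ((4, 0) : ZMod 5 × ZMod 5)).comp ((AddMonoidHom.snd (ZMod 5) (ZMod 5)).prod (AddMonoidHom.snd (ZMod 5) (ZMod 5))),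
    (AddMonoidHom.mulLeft ((4, 1) : ZMod 5 × ZMod 5)).comp ((AddMonoidHom.fst (ZMod 5) (ZMod 5)).prod (AddMonoidHom.fst (ZMod 5) (ZMod 5))) + (AddMonoidHom.mulLeft ((4, 0) : ZMod 5 × ZMod 5)).comp ((AddMonoidHom.snd (ZMod 5) (ZMod 5)).prod (AddMonoidHom.snd (ZMod 5) (ZMod 5))),
    (AddMonoidHom.mulLeft ((0, 3) : ZMod 5 × ZMod 5)).comp ((AddMonoidHom.fst (ZMod 5) (ZMod 5)).prod (AddMonoidHom.fst (ZMod 5) (ZMod 5))) + (AddMonoidHom.mulLeft ((3, 0) : ZMod 5 × ZMod 5)).comp ((AddMonoidHom.snd (ZMod 5) (ZMod 5)).prod (AddMonoidHom.snd (ZMod 5) (ZMod 5))),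
    (AddMonoidHom.mulLeft ((1, 3) : ZMod 5 × ZMod 5)).comp ((AddMonoidHom.fst (ZMod 5) (ZMod 5)).prod (AddMonoidHom.fst (ZMod 5) (ZMod 5))) + (AddMonoidHom.mulLeft ((3, 0) : ZMod 5 × ZMod 5)).comp ((AddMonoidHom.snd (ZMod 5) (ZMod 5)).prod (AddMonoidHom.snd (ZMod 5) (ZMod 5))),
    (AddMonoidHom.mulLeft ((2, 3) : ZMod 5 × ZMod 5)).comp ((AddMonoidHom.fst (ZMod 5) (ZMod 5)).prod (AddMonoidHom.fst (ZMod 5) (ZMod 5))) + (AddMonoidHom.mulLeft ((3, 0) : ZMod 5 × ZMod 5)).comp ((AddMonoidHom.snd (ZMod 5) (ZMod 5)).prod (AddMonoidHom.snd (ZMod 5) (ZMod 5))),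
    (AddMonoidHom.mulLeft ((3, 3) : ZMod 5 × ZMod 5)).comp ((AddMonoidHom.fst (ZMod 5) (ZMod 5)).prod (AddMonoidHom.fst (ZMod 5) (ZMod 5))) + (AddMonoidHom.mulLeft ((3, 0) : ZMod 5 × ZMod 5)).comp ((AddMonoidHom.snd (ZMod 5) (ZMod 5)).prod (AddMonoidHom.snd (ZMod 5) (ZMod 5))),
    (AddMonoidHom.mulLeft ((4, 3) : ZMod 5 × ZMod 5)).comp ((AddMonoidHom.fst (ZMod 5) (ZMod 5)).prod (AddMonoidHom.fst (ZMod 5) (ZMod 5))) + (AddMonoidHom.mulLeft ((3, 0) : ZMod 5 × ZMod 5)).comp ((AddMonoidHom.snd (ZMod 5) (ZMod 5)).prod (AddMonoidHom.snd (ZMod 5) (ZMod 5))),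
    (AddMonoidHom.mulLeft ((0, 2) : ZMod 5 × ZMod 5)).comp ((AddMonoidHom.fst (ZMod 5) (ZMod 5)).prod (AddMonoidHom.fst (ZMod 5) (ZMod 5))) + (AddMonoidHom.mulLeft ((2, 0) : ZMod 5 × ZMod 5)).comp ((AddMonoidHom.snd (ZMod 5) (ZMod 5)).prod (AddMonoidHom.snd (ZMod 5) (ZMod 5))),
    (AddMonoidHom.mulLeft ((1, 2) : ZMod 5 × ZMod 5)).comp ((AddMonoidHom.fst (ZMod 5) (ZMod 5)).prod (AddMonoidHom.fst (ZMod 5) (ZMod 5))) + (AddMonoidHom.mulLeft ((2, 0) : ZMod 5 × ZMod 5)).comp ((AddMonoidHom.snd (ZMod 5) (ZMod 5)).prod (AddMonoidHom.snd (ZMod 5) (ZMod 5))),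
    (AddMonoidHom.mulLeft ((2, 2) : ZMod 5 × ZMod 5)).comp ((AddMonoidHom.fst (ZMod 5) (ZMod 5)).prod (AddMonoidHom.fst (ZMod 5) (ZMod 5))) + (AddMonoidHom.mulLeft ((2, 0) : ZMod 5 × ZMod 5)).comp ((AddMonoidHom.snd (ZMod 5) (ZMod 5)).prod (AddMonoidHom.snd (ZMod 5) (ZMod 5))),
    (AddMonoidHom.mulLeft ((3, 2) : ZMod 5 × ZMod 5)).comp ((AddMonoidHom.fst (ZMod 5) (ZMod 5)).prod (AddMonoidHom.fst (ZMod 5) (ZMod 5))) + (AddMonoidHom.mulLeft ((2, 0) : ZMod 5 × ZMod 5)).comp ((AddMonoidHom.snd (ZMod 5) (ZMod 5)).prod (AddMonoidHom.snd (ZMod 5) (ZMod 5))),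
    (AddMonoidHom.mulLeft ((4, 2) : ZMod 5 × ZMod 5)).comp ((AddMonoidHom.fst (ZMod 5) (ZMod 5)).prod (AddMonoidHom.fst (ZMod 5) (ZMod 5))) + (AddMonoidHom.mulLeft ((2, 0) : ZMod 5 × ZMod 5)).comp ((AddMonoidHom.snd (ZMod 5) (ZMod 5)).prod (AddMonoidHom.snd (ZMod 5) (ZMod 5))),
    (AddMonoidHom.mulLeft ((0, 4) : ZMod 5 × ZMod 5)).comp ((AddMonoidHom.fst (ZMod 5) (ZMod 5)).prod (AddMonoidHom.fst (ZMod 5) (ZMod 5))) + (AddMonoidHom.mulLeft ((1, 0) : ZMod 5 × ZMod 5)).comp ((AddMonoidHom.snd (ZMod 5) (ZMod 5)).prod (AddMonoidHom.snd (ZMod 5) (ZMod 5))),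
    (AddMonoidHom.mulLeft ((1, 4) : ZMod 5 × ZMod 5)).comp ((AddMonoidHom.fst (ZMod 5) (ZMod 5)).prod (AddMonoidHom.fst (ZMod 5) (ZMod 5))) + (AddMonoidHom.mulLeft ((1, 0) : ZMod 5 × ZMod 5)).comp ((AddMonoidHom.snd (ZMod 5) (ZMod 5)).prod (AddMonoidHom.snd (ZMod 5) (ZMod 5))),
    (AddMonoidHom.mulLeft ((2, 4) : ZMod 5 × ZMod 5)).comp ((AddMonoidHom.fst (ZMod 5) (ZMod 5)).prod (AddMonoidHom.fst (ZMod 5) (ZMod 5))) + (AddMonoidHom.mulLeft ((1, 0) : ZMod 5 × ZMod 5)).comp ((AddMonoidHom.snd (ZMod 5) (ZMod 5)).prod (AddMonoidHom.snd (ZMod 5) (ZMod 5))),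
    (AddMonoidHom.mulLeft ((3, 4) : ZMod 5 × ZMod 5)).comp ((AddMonoidHom.fst (ZMod 5) (ZMod 5)).prod (AddMonoidHom.fst (ZMod 5) (ZMod 5))) + (AddMonoidHom.mulLeft ((1, 0) : ZMod 5 × ZMod 5)).comp ((AddMonoidHom.snd (ZMod 5) (ZMod 5)).prod (AddMonoidHom.snd (ZMod 5) (ZMod 5))),
    (AddMonoidHom.mulLeft ((4, 4) : ZMod 5 × ZMod 5)).comp ((AddMonoidHom.fst (ZMod 5) (ZMod 5)).prod (AddMonoidHom.fst (ZMod 5) (ZMod 5))) + (AddMonoidHom.mulLeft ((1, 0) : ZMod 5 × ZMod 5)).comp ((AddMonoidHom.snd (ZMod 5) (ZMod 5)).prod (AddMonoidHom.snd (ZMod 5) (ZMod 5)))]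

/-- The chunks of every representative cover every pair of (first-level, second-level) codes (kernel). -/
theorem P5_5k6.cover_chunks : ∀ d ∈ P5_5k6.reps, ∀ y₁, y₁ < (prodEnc 5 (zmodEnc 5)).g.n → ∀ y₂, y₂ < (prodEnc 5 (zmodEnc 5)).g.n →
    ∃ e ∈ P5_5k6.chunks, e.1 = d ∧ e.2.1.testBit y₁ = false ∧ e.2.2.testBit y₂ = false := by
  decide +kernel

/-- The listed maps are injective (kernel). -/
theorem P5_5k6.inj_auts : ∀ f ∈ P5_5k6.auts, Function.Injective f := by
  decide +kernel

/-- Every nonzero element is carried into the representative list by a listed map (kernel). -/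
theorem P5_5k6.cover_auts : ∀ d : ZMod 5 × ZMod 5, d ≠ 0 → ∃ f ∈ P5_5k6.auts, (prodEnc 5 (zmodEnc 5)).enc (f d) ∈ P5_5k6.reps := by
  decide +kernel

end STPP211Neg

/-- **`ℤ/5 × ℤ/5` admits no STPP family of size pattern `(2,1,1)^6`** (CKSU Def. 5.1, tree `IsSTPP`; kernel search reflected
through `exists_isSTPP_211_iff`).  No `ω` bound follows. [cite: CohnKleinbergSzegedyUmans2005, Def. 5.1] -/
theorem not_exists_isSTPP_211pow6_z5_z5 : ¬ ∃ A B C : Fin 6 → Finset (ZMod 5 × ZMod 5), IsSTPP A B C ∧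
    ∀ i, (A i).card = 2 ∧ (B i).card = 1 ∧ (C i).card = 1 :=
  STPP211Neg.not_exists_isSTPP_211_of_search2 (STPP211Neg.prodEnc 5 (STPP211Neg.zmodEnc 5)) (by decide) STPP211Neg.P5_5k6.search_all
    STPP211Neg.P5_5k6.cover_chunks STPP211Neg.P5_5k6.inj_auts STPP211Neg.P5_5k6.cover_auts

end Summit.MatrixMultiplication.OmegaCensus
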